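import Literature.Computability.AlgebraicComplexity.CircuitArithmetization
import Mathlib.Data.Nat.Size
import HarnessLib

/-!
# Boolean gadgets for Valiant's criterion: bit vectors, indicators, monomial selectors

Polynomial gadgets on a block of "bit polynomials" `E : Fin m → k[β]` together with their
values at points where every `E t` takes a Boolean value `e t ∈ {0, 1}` (`CircuitArith.toK`).
They are the building blocks of the `VP` witness in the proof that families of polynomials
definable in `P/poly` are in `VNP` (Valiant's criterion; Bürgisser 2000, Prop. 2.20; Tavenas
2014, Prop. 3.10 and the proof of Prop. 3.17), file `DefinableVNP.lean`:

* bit vectors as numbers through Batteries' `Nat.ofBits` (`ofBits_eq_sum`, `ofBits_injective`,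
  the reindexing `sum_boolVec_eq_sum_range` over `[0, 2^m)`, `ofBits_eq_zero_iff`);
* `allZeroFrom E ℓ = ∏_{t ≥ ℓ} (1 - E_t)` (value `[Nat.ofBits e < 2^ℓ]`), the binary-length
  indicator `lenInd E ℓ` (value `[Nat.size (Nat.ofBits e) = ℓ]`), `jnzInd` (`[Nat.ofBits e ≠ 0]`), `jleInd`
  (`[Nat.ofBits e ≤ 2^R]` on `R + 1` bits);
* the borrow chain `lowZero`, `decBit` and the bit vector `decVec e` of `Nat.ofBits e - 1`
  (`ofBits_decVec`);
* the monomial selector `selProd E Y = ∏_t (E_t Y_t + 1 - E_t)` (value `∏_{t : e_t} Y_t` under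
  any algebra map sending `E_t` to `[e t]`);
* size and degree bounds of all gadgets (the `E_t` being variables, except for `selProd`), and the algebra-map
  lemma `aeval_C_comp` (`aeval (C ∘ c) p = C (eval c p)`).

## References

* P. Bürgisser, *Completeness and Reduction in Algebraic Complexity Theory*, Springer 2000,
  Prop. 2.20 and its proof (Valiant's criterion), Def. 2.1 (cost).
* S. Tavenas, PhD thesis, ENS Lyon 2014, Prop. 3.10, proof of Prop. 3.17 (display (3.1)).
-/

noncomputable section

open MvPolynomial

universe u v w

namespace Literature.Computability.AlgebraicComplexity

open CircuitArith

namespace BoolGadgets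

variable {k : Type u} [CommRing k] {β : Type w}

/-! ### Bit vectors as numbers: `Nat.ofBits` -/

/-- Batteries' `Nat.ofBits e` (the number with little-endian bits `e`) as the sum
`∑_t [e t] 2^t` (bridge to the `Finset.sum` form used by the gadgets). [folklore] -/
theorem ofBits_eq_sum {m : ℕ} (e : Fin m → Bool) : Nat.ofBits e = ∑ t : Fin m, (e t).toNat * 2 ^ (t : ℕ) := by
  induction m with
  | zero => simp
  | succ m ih =>
    rw [Nat.ofBits_succ, ih, Fin.sum_univ_succ]
    simp only [Fin.val_zero, pow_zero, mul_one, Function.comp_apply, Fin.val_succ, pow_succ, Finset.mul_sum]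
    rw [add_comm]
    congr 1
    exact Finset.sum_congr rfl fun t _ => by ring

/-- `Nat.ofBits` is injective. [folklore] -/
theorem ofBits_injective {m : ℕ} : Function.Injective (Nat.ofBits (n := m)) := by
  intro e e' h
  funext t
  have := congrArg (fun v => v.testBit t.val) h
  simpa using this

/-- **Reindexing a sum over bit vectors as a sum over `[0, 2^m)`** (the bijection
`Nat.ofBits`/`Nat.testBit`). [folklore] -/
theorem sum_boolVec_eq_sum_range {M : Type*} [AddCommMonoid M] {m : ℕ} (f : ℕ → M) :
    ∑ e : Fin m → Bool, f (Nat.ofBits e) = ∑ v ∈ Finset.range (2 ^ m), f v := by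
  refine Finset.sum_nbij' (fun e => Nat.ofBits e) (fun v => fun t : Fin m => v.testBit t) ?_ ?_ ?_ ?_ ?_
  · intro e _; exact Finset.mem_range.2 (Nat.ofBits_lt_two_pow e)
  · intro v _; exact Finset.mem_univ _
  · intro e _; funext t; simp
  · intro v hv; rw [Nat.ofBits_testBit, Nat.mod_eq_of_lt (Finset.mem_range.1 hv)]
  · intro e _; rfl

/-- The all-zero vector has value `0`, and conversely. [folklore] -/
theorem ofBits_eq_zero_iff {m : ℕ} (e : Fin m → Bool) : Nat.ofBits e = 0 ↔ ∀ t, e t = false := by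
  constructor
  · intro h t
    have := Nat.testBit_ofBits_lt e t.val t.isLt
    rw [h, Nat.zero_testBit] at this
    exact this.symm
  · intro h
    have : e = fun _ => false := funext h
    subst this
    rw [ofBits_eq_sum]; simp

/-! ### Boolean points -/

/-- `toK (a && b) = toK a * toK b`. [folklore] -/
theorem toK_and (a b : Bool) : toK k (a && b) = toK k a * toK k b := by
  cases a <;> cases b <;> simp [toK]

/-- `toK (!b) = 1 - toK b`. [folklore] -/
theorem toK_not (b : Bool) : toK k (!b) = 1 - toK k b := by
  cases b <;> simp [toK]

/-- A product of Boolean values all equal to `1` is `1`. [folklore] -/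
theorem prod_toK_eq_one {ι : Type*} (s : Finset ι) (p : ι → Bool) (h : ∀ i ∈ s, p i = true) :
    ∏ i ∈ s, toK k (p i) = 1 :=
  Finset.prod_eq_one fun i hi => by rw [h i hi, toK_true]

/-- A product of Boolean values one of which is `0` is `0`. [folklore] -/
theorem prod_toK_eq_zero {ι : Type*} (s : Finset ι) (p : ι → Bool) {i : ι} (hi : i ∈ s) (h : p i = false) :
    ∏ i ∈ s, toK k (p i) = 0 :=
  Finset.prod_eq_zero hi (by rw [h, toK_false])

/-- **An algebra map with constant values is evaluation followed by `C`.** [folklore] -/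
theorem aeval_C_comp {σ τ : Type*} (c : σ → k) (p : MvPolynomial σ k) :
    aeval (fun v => (C (c v) : MvPolynomial τ k)) p = C (eval c p) := by
  induction p using MvPolynomial.induction_on with
  | C a => simp
  | add p q hp hq => rw [map_add, map_add, hp, hq, map_add]
  | mul_X p i hp => rw [map_mul, map_mul, hp, aeval_X, eval_X, map_mul]

variable {m : ℕ} (E : Fin m → MvPolynomial β k) (x : β → k) (e : Fin m → Bool)

/-! ### `allZeroFrom`: all bits from position `ℓ` on vanish -/

/-- `∏_{t ≥ ℓ} (1 - E_t)`. [cite: Burgisser2000, proof of Prop. 2.20] -/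
def allZeroFrom (ℓ : ℕ) : MvPolynomial β k :=
  ∏ t ∈ (Finset.univ : Finset (Fin m)).filter (fun t => ℓ ≤ t.val), (1 - E t)

/-- `allZeroFrom` at a Boolean point: the indicator of `Nat.ofBits e < 2^ℓ`. [folklore] -/
theorem eval_allZeroFrom (hE : ∀ t, eval x (E t) = toK k (e t)) (ℓ : ℕ) :
    eval x (allZeroFrom E ℓ) = toK k (decide (Nat.ofBits e < 2 ^ ℓ)) := by
  unfold allZeroFrom
  rw [map_prod]
  have h1 : ∀ t : Fin m, eval x (1 - E t) = toK k (!(e t)) := fun t => by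
    rw [map_sub, map_one, hE, toK_not]
  simp only [h1]
  by_cases hc : Nat.ofBits e < 2 ^ ℓ
  · rw [decide_eq_true hc, toK_true]
    refine prod_toK_eq_one _ _ fun t ht => ?_
    rw [Finset.mem_filter] at ht
    have := Nat.testBit_lt_two_pow (hc.trans_le (Nat.pow_le_pow_right (by norm_num) ht.2))
    rw [Nat.testBit_ofBits_lt _ _ t.isLt] at this
    rw [show e t = false from this]; rfl
  · rw [decide_eq_false hc, toK_false]
    -- a set bit at a position `≥ ℓ`
    have hex : ∃ t : Fin m, ℓ ≤ t.val ∧ e t = true := by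
      by_contra hne
      push Not at hne
      apply hc
      apply Nat.lt_pow_two_of_testBit
      intro i hi
      rw [Nat.testBit_ofBits]
      split
      · rename_i h
        have := hne ⟨i, h⟩ hi
        simpa using this
      · rfl
    obtain ⟨t, ht, het⟩ := hex
    exact prod_toK_eq_zero _ _ (Finset.mem_filter.2 ⟨Finset.mem_univ t, ht⟩) (by rw [het]; rfl)

/-! ### `lenInd`: the binary length -/

/-- The binary length `Nat.size v` (the length of the little-endian numeral of `v`: `0` for
`v = 0`, else `⌊log₂ v⌋ + 1`) equals `ℓ` iff `v < 2^ℓ` and (`ℓ = 0` or `2^{ℓ-1} ≤ v`). [folklore] -/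
theorem size_eq_iff (v ℓ : ℕ) : Nat.size v = ℓ ↔ v < 2 ^ ℓ ∧ (ℓ = 0 ∨ 2 ^ (ℓ - 1) ≤ v) := by
  constructor
  · intro h
    refine ⟨Nat.size_le.1 h.le, ?_⟩
    rcases Nat.eq_zero_or_pos ℓ with hℓ | hℓ
    · exact Or.inl hℓ
    · right
      by_contra hlt
      push Not at hlt
      have := Nat.size_le.2 hlt
      omega
  · rintro ⟨h1, h2⟩
    apply le_antisymm (Nat.size_le.2 h1)
    rcases h2 with rfl | h2
    · exact Nat.zero_le _
    · by_contra hlt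
      push Not at hlt
      have h3 : Nat.size v ≤ ℓ - 1 := by omega
      have := Nat.size_le.1 h3
      omega

/-- The leading-bit factor of the length indicator: `1` for `ℓ = 0`, else `E_{ℓ-1}` (or `0` if
out of range). [folklore] -/
def leadBit (ℓ : ℕ) : MvPolynomial β k :=
  if ℓ = 0 then 1 else if h : ℓ - 1 < m then E ⟨ℓ - 1, h⟩ else 0

/-- The length indicator `leadBit E ℓ · allZeroFrom E ℓ`. [cite: Tavenas2014, proof of Prop. 3.17] -/
def lenInd (ℓ : ℕ) : MvPolynomial β k :=
  leadBit E ℓ * allZeroFrom E ℓ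

/-- **`lenInd` at a Boolean point is the indicator of `Nat.size (Nat.ofBits e) = ℓ`.** [folklore] -/
theorem eval_lenInd (hE : ∀ t, eval x (E t) = toK k (e t)) (ℓ : ℕ) :
    eval x (lenInd E ℓ) = toK k (decide (Nat.size (Nat.ofBits e) = ℓ)) := by
  unfold lenInd leadBit
  rw [map_mul, eval_allZeroFrom E x e hE]
  by_cases hℓ : ℓ = 0
  · subst hℓ
    simp only [↓reduceIte, map_one, one_mul]
    congr 1
    apply Bool.decide_congr
    rw [size_eq_iff]; simp
  · rw [if_neg hℓ]
    by_cases hm : ℓ - 1 < m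
    · rw [dif_pos hm, hE, ← toK_and]
      congr 1
      rw [Bool.eq_iff_iff, Bool.and_eq_true, decide_eq_true_iff, decide_eq_true_iff, size_eq_iff]
      have hbit : e ⟨ℓ - 1, hm⟩ = (Nat.ofBits e).testBit (ℓ - 1) := (Nat.testBit_ofBits_lt e (ℓ - 1) hm).symm
      rw [hbit]
      constructor
      · rintro ⟨h1, h2⟩
        exact ⟨h2, Or.inr (Nat.ge_two_pow_of_testBit h1)⟩
      · rintro ⟨h1, h2⟩
        refine ⟨?_, h1⟩
        rcases h2 with h2 | h2
        · exact absurd h2 hℓ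
        · by_contra hb
          rw [Bool.not_eq_true] at hb
          have : Nat.ofBits e < 2 ^ (ℓ - 1) := by
            apply Nat.lt_pow_two_of_testBit
            intro i hi
            rcases Nat.lt_or_ge i ℓ with hil | hil
            · have : i = ℓ - 1 := by omega
              subst this; exact hb
            · exact Nat.testBit_lt_two_pow (h1.trans_le (Nat.pow_le_pow_right (by norm_num) hil))
          omega
    · rw [dif_neg hm, map_zero, zero_mul]
      have hfalse : decide (Nat.size (Nat.ofBits e) = ℓ) = false := by
        rw [decide_eq_false_iff_not, size_eq_iff]
        rintro ⟨-, h2⟩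
        rcases h2 with h2 | h2
        · exact hℓ h2
        · have := Nat.ofBits_lt_two_pow e
          have : 2 ^ m ≤ 2 ^ (ℓ - 1) := Nat.pow_le_pow_right (by norm_num) (by omega)
          omega
      rw [hfalse]; rfl

/-! ### `jnzInd`, `jleInd` -/

/-- `[Nat.ofBits e ≠ 0] = 1 - allZeroFrom E 0`. [cite: Tavenas2014, proof of Prop. 3.17] -/
def jnzInd : MvPolynomial β k := 1 - allZeroFrom E 0

/-- `jnzInd` at a Boolean point. [folklore] -/
theorem eval_jnzInd (hE : ∀ t, eval x (E t) = toK k (e t)) :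
    eval x (jnzInd E) = toK k (decide (Nat.ofBits e ≠ 0)) := by
  unfold jnzInd
  rw [map_sub, map_one, eval_allZeroFrom E x e hE, pow_zero]
  by_cases h : Nat.ofBits e = 0 <;> simp [h, toK]

/-- `[Nat.ofBits e ≤ 2^R]` on `R + 1` bits: bit `R` clear, or bit `R` set and all lower bits clear. [cite: Tavenas2014, proof of Prop. 3.17] -/
def jleInd {R : ℕ} (E : Fin (R + 1) → MvPolynomial β k) : MvPolynomial β k :=
  (1 - E (Fin.last R)) + E (Fin.last R) * ∏ t : Fin R, (1 - E t.castSucc)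

/-- `jleInd` at a Boolean point. [folklore] -/
theorem eval_jleInd {R : ℕ} (E : Fin (R + 1) → MvPolynomial β k) (e : Fin (R + 1) → Bool)
    (hE : ∀ t, eval x (E t) = toK k (e t)) : eval x (jleInd E) = toK k (decide (Nat.ofBits e ≤ 2 ^ R)) := by
  unfold jleInd
  rw [map_add, map_sub, map_one, map_mul, map_prod, hE]
  have h1 : ∀ t : Fin R, eval x (1 - E t.castSucc) = toK k (!(e t.castSucc)) := fun t => by
    rw [map_sub, map_one, hE, toK_not]
  simp only [h1]
  have hval : Nat.ofBits e = Nat.ofBits (fun t : Fin R => e t.castSucc) + (e (Fin.last R)).toNat * 2 ^ R := by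
    rw [ofBits_eq_sum, ofBits_eq_sum, Fin.sum_univ_castSucc]
    simp
  have hlow := Nat.ofBits_lt_two_pow (fun t : Fin R => e t.castSucc)
  cases hR : e (Fin.last R)
  · -- bit `R` clear: `Nat.ofBits e < 2^R`
    rw [hR] at hval
    simp only [Bool.toNat_false, zero_mul, add_zero] at hval
    rw [decide_eq_true (show Nat.ofBits e ≤ 2 ^ R by omega)]
    simp [toK]
  · rw [hR] at hval
    simp only [Bool.toNat_true, one_mul] at hval
    by_cases hz : ∀ t : Fin R, e t.castSucc = false
    · have hz' : Nat.ofBits (fun t : Fin R => e t.castSucc) = 0 := (ofBits_eq_zero_iff _).2 hz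
      rw [prod_toK_eq_one _ _ (fun t _ => by rw [hz t]; rfl), decide_eq_true (show Nat.ofBits e ≤ 2 ^ R by omega)]
      simp [toK]
    · push Not at hz
      obtain ⟨t, ht⟩ := hz
      replace ht : e t.castSucc = true := by simpa using ht
      have hz' : Nat.ofBits (fun t : Fin R => e t.castSucc) ≠ 0 := fun h =>
        by have := (ofBits_eq_zero_iff _).1 h t; rw [ht] at this; exact Bool.noConfusion this
      rw [prod_toK_eq_zero _ _ (Finset.mem_univ t) (by rw [ht]; rfl),
        decide_eq_false (show ¬ Nat.ofBits e ≤ 2 ^ R by omega)]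
      simp [toK]

/-! ### The borrow chain: bits of `Nat.ofBits e - 1` -/

/-- `∏_{t' < t} (1 - E_{t'})`: all bits below `t` vanish. [folklore] -/
def lowZero (t : ℕ) : MvPolynomial β k :=
  ∏ t' ∈ (Finset.univ : Finset (Fin m)).filter (fun t' => t'.val < t), (1 - E t')

/-- "All bits below `t` vanish", as a Boolean. [folklore] -/
def lowZeroB (e : Fin m → Bool) (t : ℕ) : Bool := decide (∀ t' : Fin m, t'.val < t → e t' = false)

/-- `lowZero` at a Boolean point. [folklore] -/
theorem eval_lowZero (hE : ∀ t, eval x (E t) = toK k (e t)) (t : ℕ) :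
    eval x (lowZero E t) = toK k (lowZeroB e t) := by
  unfold lowZero lowZeroB
  rw [map_prod]
  have h1 : ∀ t' : Fin m, eval x (1 - E t') = toK k (!(e t')) := fun t' => by
    rw [map_sub, map_one, hE, toK_not]
  simp only [h1]
  by_cases hc : ∀ t' : Fin m, t'.val < t → e t' = false
  · rw [decide_eq_true hc, toK_true]
    exact prod_toK_eq_one _ _ fun t' ht' => by rw [hc t' (Finset.mem_filter.1 ht').2]; rfl
  · rw [decide_eq_false hc, toK_false]
    push Not at hc
    obtain ⟨t', ht', he'⟩ := hc
    replace he' : e t' = true := by simpa using he'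
    exact prod_toK_eq_zero _ _ (Finset.mem_filter.2 ⟨Finset.mem_univ t', ht'⟩) (by rw [he']; rfl)

/-- Bit `t` of the decrement: `E_t ⊕ lowZero_t = E_t + lowZero_t - 2 E_t lowZero_t`. [cite: Tavenas2014, proof of Prop. 3.17] -/
def decBit (t : Fin m) : MvPolynomial β k :=
  E t + lowZero E t - 2 * (E t * lowZero E t)

/-- The bit vector of `Nat.ofBits e - 1` (for `Nat.ofBits e ≥ 1`): bit `t` flips iff all lower bits vanish. [folklore] -/
def decVec (e : Fin m → Bool) : Fin m → Bool := fun t => xor (e t) (lowZeroB e t)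

/-- `decBit` at a Boolean point. [folklore] -/
theorem eval_decBit (hE : ∀ t, eval x (E t) = toK k (e t)) (t : Fin m) :
    eval x (decBit E t) = toK k (decVec e t) := by
  unfold decBit decVec
  rw [map_sub, map_add, map_mul, map_mul, hE, eval_lowZero E x e hE]
  cases e t <;> cases lowZeroB e t <;> norm_num [toK]

/-- `lowZeroB` peels off the least significant bit. [folklore] -/
theorem lowZeroB_succ {m : ℕ} (e : Fin (m + 1) → Bool) (t : ℕ) :
    lowZeroB e (t + 1) = (!(e 0) && lowZeroB (e ∘ Fin.succ) t) := by
  unfold lowZeroB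
  by_cases h0 : e 0 = false
  · simp only [h0, Bool.not_false, Bool.true_and]
    apply Bool.decide_congr
    constructor
    · intro h t' ht'; exact h t'.succ (by simp; omega)
    · intro h t' ht'
      rcases Fin.eq_zero_or_eq_succ t' with rfl | ⟨s, rfl⟩
      · exact h0
      · exact h s (by simpa using ht')
  · rw [Bool.not_eq_false] at h0
    simp only [h0, Bool.not_true, Bool.false_and, decide_eq_false_iff_not]
    intro h
    have := h 0 (by simp)
    rw [h0] at this; exact Bool.noConfusion this

/-- `lowZeroB e 0` holds vacuously. [folklore] -/
theorem lowZeroB_zero (e : Fin m → Bool) : lowZeroB e 0 = true := by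
  unfold lowZeroB; simp

/-- **The borrow chain computes the decrement**: `Nat.ofBits (decVec e) = Nat.ofBits e - 1` for `Nat.ofBits e ≥ 1`. [folklore] -/
theorem ofBits_decVec {m : ℕ} (e : Fin m → Bool) (he : 1 ≤ Nat.ofBits e) : Nat.ofBits (decVec e) = Nat.ofBits e - 1 := by
  induction m with
  | zero => simp at he
  | succ m ih =>
    rw [Nat.ofBits_succ, Nat.ofBits_succ e]
    have h0 : decVec e 0 = !(e 0) := by simp [decVec, lowZeroB_zero]
    have hs : ∀ t : Fin m, decVec e t.succ = xor (e t.succ) (!(e 0) && lowZeroB (e ∘ Fin.succ) t) := by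
      intro t; rw [decVec, ← lowZeroB_succ]; rfl
    rw [h0]
    cases he0 : e 0
    · -- borrow propagates
      simp only [he0, Bool.not_false, Bool.true_and] at hs ⊢
      have hrec : decVec e ∘ Fin.succ = decVec (e ∘ Fin.succ) := by
        funext t; rw [Function.comp_apply, hs]; rfl
      rw [hrec]
      have he' : 1 ≤ Nat.ofBits (e ∘ Fin.succ) := by
        rw [Nat.ofBits_succ, he0] at he; simp at he; omega
      rw [ih _ he']
      simp; omega
    · -- no borrow
      simp only [he0, Bool.not_true, Bool.false_and, Bool.xor_false] at hs ⊢
      have hrec : decVec e ∘ Fin.succ = e ∘ Fin.succ := by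
        funext t; rw [Function.comp_apply, hs]; rfl
      rw [hrec]
      simp

/-- The bits of `decVec e` are the bits of `Nat.ofBits e - 1` (for `Nat.ofBits e ≥ 1`). [folklore] -/
theorem decVec_eq_testBit {m : ℕ} (e : Fin m → Bool) (he : 1 ≤ Nat.ofBits e) (t : Fin m) :
    decVec e t = (Nat.ofBits e - 1).testBit t := by
  rw [← ofBits_decVec e he, Nat.testBit_ofBits_lt _ _ t.isLt]

/-! ### The monomial selector -/

/-- `∏_t (E_t · Y_t + (1 - E_t))`: selects the product of the `Y_t` with `e t = 1`. [cite: Tavenas2014, proof of Prop. 3.17, (3.1)] -/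
def selProd {n : ℕ} (E Y : Fin n → MvPolynomial β k) : MvPolynomial β k :=
  ∏ t : Fin n, (E t * Y t + (1 - E t))

/-- **The selector under an algebra map sending `E_t` to `[e t]`.** [folklore] -/
theorem aeval_selProd {n : ℕ} {S : Type*} [CommRing S] [Algebra k S] (φ : β → S)
    (E Y : Fin n → MvPolynomial β k) (e : Fin n → Bool)
    (hE : ∀ t, aeval φ (E t) = algebraMap k S (toK k (e t))) :
    aeval φ (selProd E Y) = ∏ t : Fin n, (if e t then aeval φ (Y t) else 1) := by
  unfold selProd
  rw [map_prod]
  refine Finset.prod_congr rfl fun t _ => ?_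
  rw [map_add, map_mul, map_sub, map_one, hE]
  cases e t <;> simp [toK]

/-! ### Size and degree of the gadgets (variables as bits) -/

section Cost

variable (hE0 : ∀ t, complexity (E t) = 0) (hE1 : ∀ t, (E t).totalDegree ≤ 1)
include hE0 in
/-- `L(allZeroFrom) ≤ 3m`. [cite: Burgisser2000, Def. 2.1] -/
theorem complexity_allZeroFrom_le (ℓ : ℕ) : complexity (allZeroFrom E ℓ) ≤ 3 * m := by
  unfold allZeroFrom
  refine (complexity_finset_prod_le _ _).trans ?_
  have h1 : ∀ t : Fin m, complexity (1 - E t) ≤ 2 := fun t => (complexity_one_sub_le _).trans (by rw [hE0])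
  calc ∑ t ∈ (Finset.univ : Finset (Fin m)).filter (fun t => ℓ ≤ t.val), complexity (1 - E t) +
        ((Finset.univ : Finset (Fin m)).filter (fun t => ℓ ≤ t.val)).card
      ≤ ∑ _t ∈ (Finset.univ : Finset (Fin m)).filter (fun t => ℓ ≤ t.val), 2 +
        ((Finset.univ : Finset (Fin m)).filter (fun t => ℓ ≤ t.val)).card := by
          gcongr with t; exact h1 t
    _ ≤ 3 * m := by
        rw [Finset.sum_const, smul_eq_mul]
        have := Finset.card_filter_le (Finset.univ : Finset (Fin m)) (fun t => ℓ ≤ t.val)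
        rw [Finset.card_univ, Fintype.card_fin] at this
        omega

include hE0 in
/-- `L(lowZero) ≤ 3m`. [cite: Burgisser2000, Def. 2.1] -/
theorem complexity_lowZero_le (t : ℕ) : complexity (lowZero E t) ≤ 3 * m := by
  unfold lowZero
  refine (complexity_finset_prod_le _ _).trans ?_
  have h1 : ∀ t : Fin m, complexity (1 - E t) ≤ 2 := fun t => (complexity_one_sub_le _).trans (by rw [hE0])
  calc ∑ t' ∈ (Finset.univ : Finset (Fin m)).filter (fun t' => t'.val < t), complexity (1 - E t') +
        ((Finset.univ : Finset (Fin m)).filter (fun t' => t'.val < t)).card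
      ≤ ∑ _t' ∈ (Finset.univ : Finset (Fin m)).filter (fun t' => t'.val < t), 2 +
        ((Finset.univ : Finset (Fin m)).filter (fun t' => t'.val < t)).card := by
          gcongr with t'; exact h1 t'
    _ ≤ 3 * m := by
        rw [Finset.sum_const, smul_eq_mul]
        have := Finset.card_filter_le (Finset.univ : Finset (Fin m)) (fun t' => t'.val < t)
        rw [Finset.card_univ, Fintype.card_fin] at this
        omega

include hE0 in
/-- `L(leadBit) = 0`. [cite: Burgisser2000, Def. 2.1] -/
theorem complexity_leadBit (ℓ : ℕ) : complexity (leadBit E ℓ) = 0 := by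
  unfold leadBit
  split_ifs
  · rw [← C_1]; exact complexity_C_holds _
  · exact hE0 _
  · exact complexity_zero'

include hE0 in
/-- `L(lenInd) ≤ 3m + 1`. [cite: Burgisser2000, Def. 2.1] -/
theorem complexity_lenInd_le (ℓ : ℕ) : complexity (lenInd E ℓ) ≤ 3 * m + 1 := by
  unfold lenInd
  refine (complexity_mul_le_holds _ _).trans ?_
  rw [complexity_leadBit E hE0]
  have := complexity_allZeroFrom_le E hE0 ℓ
  omega

include hE0 in
/-- `L(jnzInd) ≤ 3m + 2`. [cite: Burgisser2000, Def. 2.1] -/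
theorem complexity_jnzInd_le : complexity (jnzInd E) ≤ 3 * m + 2 := by
  unfold jnzInd
  refine (complexity_one_sub_le _).trans ?_
  have := complexity_allZeroFrom_le E hE0 0
  omega

/-- `L(jleInd) ≤ 3R + 4` (variables as bits). [cite: Burgisser2000, Def. 2.1] -/
theorem complexity_jleInd_le {R : ℕ} (E : Fin (R + 1) → MvPolynomial β k) (hE0 : ∀ t, complexity (E t) = 0) :
    complexity (jleInd E) ≤ 3 * R + 4 := by
  unfold jleInd
  have h1 : complexity (1 - E (Fin.last R)) ≤ 2 := (complexity_one_sub_le _).trans (by rw [hE0])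
  have h2 : complexity (∏ t : Fin R, (1 - E t.castSucc)) ≤ 3 * R := by
    refine (complexity_finset_prod_le _ _).trans ?_
    calc ∑ t : Fin R, complexity (1 - E t.castSucc) + (Finset.univ : Finset (Fin R)).card
        ≤ ∑ _t : Fin R, 2 + (Finset.univ : Finset (Fin R)).card := by
          gcongr with t; exact (complexity_one_sub_le _).trans (by rw [hE0])
      _ = 3 * R := by simp only [Finset.sum_const, Finset.card_univ, Fintype.card_fin, smul_eq_mul]; ring
  have h3 := complexity_mul_le_holds (E (Fin.last R)) (∏ t : Fin R, (1 - E t.castSucc))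
  have h4 := complexity_add_le_holds (1 - E (Fin.last R)) (E (Fin.last R) * ∏ t : Fin R, (1 - E t.castSucc))
  rw [hE0] at h3
  omega

include hE0 in
/-- `L(decBit) ≤ 6m + 6`. [cite: Burgisser2000, Def. 2.1] -/
theorem complexity_decBit_le (t : Fin m) : complexity (decBit E t) ≤ 6 * m + 6 := by
  unfold decBit
  have hz := complexity_lowZero_le E hE0 t
  have h1 := complexity_add_le_holds (E t) (lowZero E t)
  have h2 := complexity_mul_le_holds (E t) (lowZero E t)
  have h3 : complexity (2 * (E t * lowZero E t)) ≤ complexity (E t * lowZero E t) + 1 := by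
    rw [show (2 : MvPolynomial β k) * (E t * lowZero E t) = (2 : k) • (E t * lowZero E t) by
      rw [smul_eq_C_mul]; rfl]
    exact complexity_smul_le_holds _ _
  have h4 : complexity (E t + lowZero E t - 2 * (E t * lowZero E t)) ≤
      complexity (E t + lowZero E t) + complexity (2 * (E t * lowZero E t)) + 2 := by
    rw [sub_eq_add_neg, show -(2 * (E t * lowZero E t)) = (-1 : k) • (2 * (E t * lowZero E t)) by
      rw [neg_one_smul]]
    refine (complexity_add_le_holds _ _).trans ?_
    have := complexity_smul_le_holds (σ := β) (-1 : k) (2 * (E t * lowZero E t))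
    omega
  rw [hE0] at h1 h2
  omega

/-- `L(selProd E Y) ≤ ∑_t (2 L(E_t) + L(Y_t)) + 5n`. [cite: Burgisser2000, Def. 2.1] -/
theorem complexity_selProd_le {n : ℕ} (E Y : Fin n → MvPolynomial β k) :
    complexity (selProd E Y) ≤ ∑ t : Fin n, (2 * complexity (E t) + complexity (Y t)) + 5 * n := by
  unfold selProd
  refine (complexity_finset_prod_le _ _).trans ?_
  have h1 : ∀ t : Fin n, complexity (E t * Y t + (1 - E t)) ≤ 2 * complexity (E t) + complexity (Y t) + 4 := by
    intro t
    have ha := complexity_add_le_holds (E t * Y t) (1 - E t)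
    have hm := complexity_mul_le_holds (E t) (Y t)
    have hs := complexity_one_sub_le (E t)
    omega
  calc ∑ t : Fin n, complexity (E t * Y t + (1 - E t)) + (Finset.univ : Finset (Fin n)).card
      ≤ ∑ t : Fin n, (2 * complexity (E t) + complexity (Y t) + 4) + (Finset.univ : Finset (Fin n)).card := by
        gcongr with t; exact h1 t
    _ = ∑ t : Fin n, (2 * complexity (E t) + complexity (Y t)) + 5 * n := by
        rw [Finset.sum_add_distrib]
        simp only [Finset.sum_const, Finset.card_univ, Fintype.card_fin, smul_eq_mul]; ring

include hE1 in
/-- `deg (allZeroFrom) ≤ m`. [folklore] -/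
theorem totalDegree_allZeroFrom_le (ℓ : ℕ) : (allZeroFrom E ℓ).totalDegree ≤ m := by
  unfold allZeroFrom
  refine (totalDegree_finsetProd _ _).trans ?_
  calc ∑ t ∈ (Finset.univ : Finset (Fin m)).filter (fun t => ℓ ≤ t.val), (1 - E t).totalDegree
      ≤ ∑ _t ∈ (Finset.univ : Finset (Fin m)).filter (fun t => ℓ ≤ t.val), 1 :=
        Finset.sum_le_sum fun t _ => (totalDegree_one_sub_le _).trans (hE1 t)
    _ ≤ m := by
        rw [Finset.sum_const, smul_eq_mul, mul_one]
        have := Finset.card_filter_le (Finset.univ : Finset (Fin m)) (fun t => ℓ ≤ t.val)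
        rwa [Finset.card_univ, Fintype.card_fin] at this

include hE1 in
/-- `deg (lowZero) ≤ m`. [folklore] -/
theorem totalDegree_lowZero_le (t : ℕ) : (lowZero E t).totalDegree ≤ m := by
  unfold lowZero
  refine (totalDegree_finsetProd _ _).trans ?_
  calc ∑ t' ∈ (Finset.univ : Finset (Fin m)).filter (fun t' => t'.val < t), (1 - E t').totalDegree
      ≤ ∑ _t' ∈ (Finset.univ : Finset (Fin m)).filter (fun t' => t'.val < t), 1 :=
        Finset.sum_le_sum fun t' _ => (totalDegree_one_sub_le _).trans (hE1 t')
    _ ≤ m := by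
        rw [Finset.sum_const, smul_eq_mul, mul_one]
        have := Finset.card_filter_le (Finset.univ : Finset (Fin m)) (fun t' => t'.val < t)
        rwa [Finset.card_univ, Fintype.card_fin] at this

include hE1 in
/-- `deg (leadBit) ≤ 1`. [folklore] -/
theorem totalDegree_leadBit_le (ℓ : ℕ) : (leadBit E ℓ).totalDegree ≤ 1 := by
  unfold leadBit
  split_ifs
  · rw [totalDegree_one]; exact Nat.zero_le _
  · exact hE1 _
  · rw [totalDegree_zero]; exact Nat.zero_le _

include hE1 in
/-- `deg (lenInd) ≤ m + 1`. [folklore] -/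
theorem totalDegree_lenInd_le (ℓ : ℕ) : (lenInd E ℓ).totalDegree ≤ m + 1 := by
  unfold lenInd
  refine (totalDegree_mul _ _).trans ?_
  have h1 := totalDegree_leadBit_le E hE1 ℓ
  have h2 := totalDegree_allZeroFrom_le E hE1 ℓ
  omega

include hE1 in
/-- `deg (jnzInd) ≤ m`. [folklore] -/
theorem totalDegree_jnzInd_le : (jnzInd E).totalDegree ≤ m := by
  unfold jnzInd
  exact (totalDegree_one_sub_le _).trans (totalDegree_allZeroFrom_le E hE1 0)

/-- `deg (jleInd) ≤ R + 1`. [folklore] -/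
theorem totalDegree_jleInd_le {R : ℕ} (E : Fin (R + 1) → MvPolynomial β k) (hE1 : ∀ t, (E t).totalDegree ≤ 1) :
    (jleInd E).totalDegree ≤ R + 1 := by
  unfold jleInd
  refine (totalDegree_add _ _).trans (max_le ((totalDegree_one_sub_le _).trans ((hE1 _).trans (by omega))) ?_)
  refine (totalDegree_mul _ _).trans ?_
  have h2 : (∏ t : Fin R, (1 - E t.castSucc)).totalDegree ≤ R := by
    refine (totalDegree_finsetProd _ _).trans ?_
    calc ∑ t : Fin R, (1 - E t.castSucc).totalDegree ≤ ∑ _t : Fin R, 1 :=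
          Finset.sum_le_sum fun t _ => (totalDegree_one_sub_le _).trans (hE1 _)
      _ = R := by simp
  have h1 := hE1 (Fin.last R)
  omega

include hE1 in
/-- `deg (decBit) ≤ m + 1`. [folklore] -/
theorem totalDegree_decBit_le (t : Fin m) : (decBit E t).totalDegree ≤ m + 1 := by
  unfold decBit
  have hz := totalDegree_lowZero_le E hE1 t
  have h1 := hE1 t
  refine (totalDegree_sub _ _).trans (max_le ((totalDegree_add _ _).trans (max_le (by omega) (by omega))) ?_)
  refine (totalDegree_mul _ _).trans ?_
  have h2 : (2 : MvPolynomial β k).totalDegree = 0 := by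
    rw [show (2 : MvPolynomial β k) = C 2 from (map_ofNat C 2).symm]; exact totalDegree_C _
  have h3 := totalDegree_mul (E t) (lowZero E t)
  omega

/-- `deg (selProd E Y) ≤ ∑_t (deg E_t + deg Y_t)`. [folklore] -/
theorem totalDegree_selProd_le {n : ℕ} (E Y : Fin n → MvPolynomial β k) :
    (selProd E Y).totalDegree ≤ ∑ t : Fin n, ((E t).totalDegree + (Y t).totalDegree) := by
  unfold selProd
  refine (totalDegree_finsetProd _ _).trans (Finset.sum_le_sum fun t _ => ?_)
  refine (totalDegree_add _ _).trans (max_le (totalDegree_mul _ _) ((totalDegree_one_sub_le _).trans (by omega)))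

end Cost

end BoolGadgets

end Literature.Computability.AlgebraicComplexity
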